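import Summits.BirchSwinnertonDyer.BirchSwinnertonDyer.Theorems.SchneiderFreeAdditiveX3AnticycControlAdditiveOfTorsAtoms
import Summits.BirchSwinnertonDyer.Rank1Residual.X11b.LocalKernelCoinvariantsExact
import Summits.BirchSwinnertonDyer.Rank1Residual.X11b.BDPRouteLocalKernelAtPPadic
import HarnessLib

/-!
# Crux `AnticycControlAdditiveK` (route `SchneiderFreeAdditiveX3`, stmt-BirchSwinnertonDyer-19295):
# the registered stub `stub_kerLoc` (KER-𝔭) of skeleton v3-K, PROVED — `#ker r_𝔭 = p^t` for some `t`

Seat `bsd-schneider-door-c5` (cell `bsd-schneider-ideate`), gen 4. The atom (KER-𝔭) of door-c4's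
torsion-robust control count (`additiveControlOnTreeAt_of_torsAtoms`): the local kernel
`ker r_𝔭 = ker (H¹(K_𝔭, E[p^∞]) → H¹(K_{∞,w}, E[p^∞]))` at the degree-one prime `𝔭 ∣ p` has order a
power of `p`, registered by P2 g8 as `stub_kerLoc` (signature verbatim below), UNCONDITIONALLY — no
Fin_v (finiteness of `E(K_{∞,w})[p^∞]`, door-c4's hypothesis pinning `t = t_p`, p427301) and no
non-splitting input (Brink):

* if `D_𝔭 ≤ ker κ` (the place splits completely) the restriction is along equal subgroups, an
  isomorphism (`resOfLe_comp_holds`, `resOfLe_refl_holds`), so `ker r_𝔭 = 0` and `t = 0`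
  (`natCard_localKer_eq_one_of_decomp_le`);
* otherwise X11b's EXACT transport `natCard_localKer_eq_natCard_quotient_range_decompSubOne` (with
  the generator of `exists_mem_decomp_generate`) gives `#ker r_𝔭 = #(B_𝔭/(g − 1)B_𝔭)`,
  `B_𝔭 = E[p^∞]^{ker κ ⊓ D_𝔭}` `p`-primary; `ker r_𝔭` is finite because `#ker r_𝔭 ≤ #E[p^∞]^{D_𝔭} ≤
  #E_K(K_𝔭)[p^∞] = #E(ℚ_p)[p^∞] < ∞` (tree: `natCard_localKer_le_natCard_fixedPoints`,
  `natCard_fixedPoints_decomp_le_natCard_primaryComponent`,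
  `finite_and_natCard_primaryComponent_adicCompletion_eq_padic`), so the quotient is a FINITE
  `p`-primary group, of order `p^t` (`natCard_localKer_eq_pow_of_not_decomp_le`).

So door-c4's glue input `#ker r_𝔭 = p^t` is available at every frame with SOME `t`; `t = t_p` is what
still needs Fin_v. Theorems only; no `Prop` fact; no `sorry`; closes nothing by itself (one of six
registered stubs of the crux); BSD is not proved by any of this.

References: [GreenbergLNM1716] §3 Lemma 3.3 (proof, p. 87), p. 90.
-/

noncomputable section

open scoped Classical

open WeierstrassCurve NumberField IsDedekindDomain Field Literature.NumberTheory.EllipticCurves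
  Literature.NumberTheory.EllipticCurves.ModularForms
  Literature.NumberTheory.EllipticCurves.GreenbergSelmer
  Literature.NumberTheory.GaloisRepresentations
  Literature.NumberTheory.EllipticCurves.Rank1Residual
  Literature.NumberTheory.EllipticCurves.Rank1Residual.Typed
  Summit.BirchSwinnertonDyer.Rank1Residual
  Summit.BirchSwinnertonDyer.Rank1Residual.X11b
  Summit.BirchSwinnertonDyer.Rank1Residual.X11b.AcSelmer
  Summit.BirchSwinnertonDyer.BirchSwinnertonDyer.Theorems.SchneiderFree
  Summit.BirchSwinnertonDyer.BirchSwinnertonDyer.Theorems.SchneiderFreeControlAtoms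

set_option linter.dupNamespace false

namespace Summit.BirchSwinnertonDyer.BirchSwinnertonDyer.Theorems.SchneiderFreeAdditiveX3

universe u

section AnyPlace

variable {K : Type u} [Field K] [NumberField K] (W : WeierstrassCurve K) (p : ℕ)
  [hp : Fact p.Prime] (κ : ZpExtension K p) (v : HeightOneSpectrum (𝓞 K))

/-- **A completely split place has trivial local kernel.** If `D_v ≤ ker κ` then
`ker r_v = ker (H¹(⊤ ⊓ D_v, E[p^∞]) → H¹(ker κ ⊓ D_v, E[p^∞]))` is a restriction along EQUAL subgroups,
hence injective (`res ∘ res = res_refl = id`), so `#ker r_v = 1`. [folklore] -/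
theorem natCard_localKer_eq_one_of_decomp_le (hv : decomp v ≤ κ.kerSubgroup) :
    Nat.card (localKer κ.kerSubgroup (W.geomPrimaryTorsion p) v) = 1 := by
  have h₁ : κ.kerSubgroup ⊓ decomp v ≤ (⊤ : Subgroup (absoluteGaloisGroup K)) ⊓ decomp v :=
    inf_le_inf_right (decomp v) le_top
  have h₂ : (⊤ : Subgroup (absoluteGaloisGroup K)) ⊓ decomp v ≤ κ.kerSubgroup ⊓ decomp v :=
    fun x hx ↦ Subgroup.mem_inf.mpr ⟨hv (Subgroup.mem_inf.mp hx).2, (Subgroup.mem_inf.mp hx).2⟩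
  have hcomp : (Literature.NumberTheory.EllipticCurves.resOfLe (W.geomPrimaryTorsion p) h₂).comp
      (Literature.NumberTheory.EllipticCurves.resOfLe (W.geomPrimaryTorsion p) h₁) =
        AddMonoidHom.id _ := by
    rw [Literature.NumberTheory.EllipticCurves.resOfLe_comp_holds]
    exact Literature.NumberTheory.EllipticCurves.resOfLe_refl_holds _
  haveI : Subsingleton (localKer κ.kerSubgroup (W.geomPrimaryTorsion p) v) := by
    refine ⟨fun a b ↦ Subtype.ext ?_⟩
    have key : ∀ c : localKer κ.kerSubgroup (W.geomPrimaryTorsion p) v,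
        (c : subgroupH1 ((⊤ : Subgroup (absoluteGaloisGroup K)) ⊓ decomp v)
          (W.geomPrimaryTorsion p)) = 0 := by
      intro c
      have hc : Literature.NumberTheory.EllipticCurves.resOfLe (W.geomPrimaryTorsion p) h₁ c.1 = 0 :=
        (AddMonoidHom.mem_ker).mp c.2
      have h := congrArg (fun f ↦ f c.1) hcomp
      simp only [AddMonoidHom.coe_comp, Function.comp_apply, hc, map_zero,
        AddMonoidHom.id_apply] at h
      exact h.symm
    rw [key a, key b]
  exact Nat.card_of_subsingleton (0 : localKer κ.kerSubgroup (W.geomPrimaryTorsion p) v)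

variable [W.IsElliptic]

/-- **`#ker r_v` is a power of `p` at a place that does not split completely, as soon as
`E(K̄)[p^∞]^{D_v}` is finite** (no Fin_v): by the exact transport
`#ker r_v = #(B_v/(g − 1)B_v)` (`B_v = E[p^∞]^{ker κ ⊓ D_v}`, `g` a topological generator of `D_v`
modulo `D_v ⊓ ker κ`), the right side being a finite (`#ker r_v ≤ #E(K̄)[p^∞]^{D_v}`) `p`-primary
group. [cite: GreenbergLNM1716, §3 Lemma 3.3 (proof, p. 87)] -/
theorem natCard_localKer_eq_pow_of_not_decomp_le
    [hfix : Finite (FixedPoints.addSubgroup ↥(decomp v) (W.geomPrimaryTorsion p))]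
    (hv : ¬ decomp v ≤ κ.kerSubgroup) :
    ∃ t : ℕ, Nat.card (localKer κ.kerSubgroup (W.geomPrimaryTorsion p) v) = p ^ t := by
  have hprim : IsPrimaryTorsion p (W.geomPrimaryTorsion p) := fun Q ↦
    (AddCommGroup.mem_primaryComponent.mp Q.2).imp fun k hk ↦
      Subtype.ext (by rw [AddSubmonoidClass.coe_nsmul, hk, ZeroMemClass.coe_zero])
  obtain ⟨g, hgen⟩ := exists_mem_decomp_generate κ v
  have hgD : (g : absoluteGaloisGroup K) ∈ decomp v := (Subgroup.mem_inf.mp g.2).2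
  set B := FixedPoints.addSubgroup ↥(κ.kerSubgroup ⊓ decomp v) (W.geomPrimaryTorsion p)
  set φ : B →+ B := decompSubOne κ (W.geomPrimaryTorsion p) (g : absoluteGaloisGroup K) hgD with hφ
  have htr := natCard_localKer_eq_natCard_quotient_range_decompSubOne κ (W.geomPrimaryTorsion p)
    (W.continuous_smul_geomPrimaryTorsion p) hprim hv hgen
  -- `ker r_v` is finite, hence so is the quotient
  obtain ⟨hfinK, -⟩ := natCard_localKer_le_natCard_fixedPoints W p κ v
  haveI := hfinK
  have hne : Nat.card (B ⧸ φ.range) ≠ 0 := by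
    rw [← htr]
    exact Nat.card_pos.ne'
  haveI : Finite (B ⧸ φ.range) := Nat.finite_of_card_ne_zero hne
  -- a finite `p`-primary group has `p`-power order
  have hPG : IsPGroup p (Multiplicative (B ⧸ φ.range)) := fun x ↦ by
    obtain ⟨b, hb⟩ := QuotientAddGroup.mk_surjective (Multiplicative.toAdd x)
    obtain ⟨k, hk⟩ := hprim ((b : B) : W.geomPrimaryTorsion p)
    refine ⟨k, ?_⟩
    apply Multiplicative.toAdd.injective
    rw [toAdd_pow, toAdd_one, ← hb, ← QuotientAddGroup.mk_nsmul]
    have hkb : p ^ k • b = 0 := Subtype.ext (by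
      rw [AddSubmonoidClass.coe_nsmul, ZeroMemClass.coe_zero]; exact hk)
    rw [hkb, QuotientAddGroup.mk_zero]
  obtain ⟨t, ht⟩ := IsPGroup.iff_card.mp hPG
  exact ⟨t, by rw [htr]; exact ht⟩

end AnyPlace

section Padic

variable (W : WeierstrassCurve ℚ) [W.IsElliptic] [W.IsGloballyMinimal] (p : ℕ) [hp : Fact p.Prime]
  {K : Type} [Field K] [NumberField K] (κ : ZpExtension K p)

/-- **(KER-𝔭) for `E/ℚ` at a degree-one `𝔭 ∣ p`, unconditionally: `#ker r_𝔭 = p^t` for some `t`**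
(any number field `K`, any `ℤ_p`-extension `κ`). `E(K̄)[p^∞]^{D_𝔭}` is finite since it embeds in
`E_K(K_𝔭)[p^∞] ≃ E(ℚ_p)[p^∞]` (tree); then split/non-split dichotomy above. [folklore] -/
theorem exists_natCard_localKer_eq_pow (𝔭 : HeightOneSpectrum (𝓞 K))
    (h𝔭 : ((p : ℕ) : 𝓞 K) ∈ 𝔭.asIdeal) (he : 𝔭.asIdeal.ramificationIdx (𝓞 ℚ) = 1)
    (hf : 𝔭.asIdeal.inertiaDeg (𝓞 ℚ) = 1) :
    ∃ t : ℕ, Nat.card (localKer κ.kerSubgroup ((W.baseChange K).geomPrimaryTorsion p) 𝔭) = p ^ t := by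
  haveI hEK : (W.baseChange K).IsElliptic := by rw [baseChange]; infer_instance
  by_cases hv : decomp 𝔭 ≤ κ.kerSubgroup
  · exact ⟨0, by rw [pow_zero]; exact natCard_localKer_eq_one_of_decomp_le (W.baseChange K) p κ 𝔭 hv⟩
  · obtain ⟨hfinv, -⟩ := finite_and_natCard_primaryComponent_adicCompletion_eq_padic W p 𝔭 h𝔭 he hf
    haveI := hfinv
    obtain ⟨hfinF, -⟩ := natCard_fixedPoints_decomp_le_natCard_primaryComponent (W.baseChange K) p 𝔭
    haveI := hfinF
    exact natCard_localKer_eq_pow_of_not_decomp_le (W.baseChange K) p κ 𝔭 hv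

/-- **Registered stub `stub_kerLoc` of crux `AnticycControlAdditiveK` (skeleton v3-K), signature
verbatim: `#ker r_𝔭 = p^t` for some `t`** on every B6 Heegner datum and anticyclotomic frame — by
`exists_natCard_localKer_eq_pow`; of the stub's binders only the curve, `K`, `κ` and the degree-one
`𝔭 ∣ p` are used. [cite: GreenbergLNM1716, §3 Lemma 3.3 (p. 87)] -/
theorem stub_kerLoc :
    ∀ (W : WeierstrassCurve ℚ) [W.IsElliptic] [W.IsGloballyMinimal] (p : ℕ) [Fact p.Prime],
      W.analyticRank = 1 → p ≠ 2 → ClassX3 W p → Additive.SubSemistableTwist W p →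
      ∀ (N : ℕ) [NeZero N] (K : Type) [Field K] [NumberField K]
        (Dt : ModularParametrizationData W N) (H : HeegnerDatum N (NumberField.discr K)) (ι : K →+* ℂ)
        (P : (W.baseChange K).toAffine.Point),
        W.analyticRank = 1 → Additive.N10.Locus W p → W.conductorNorm ℤ = N →
        ∀ hK : IsImaginaryQuadratic K,
        Odd (NumberField.discr K) → ¬ p ∣ Units.torsionOrder K → SatisfiesHeegnerHypothesis N K →
        (W.quadraticTwist (NumberField.discr K : ℚ)).entireLFunction 1 ≠ 0 →
        WeierstrassCurve.Affine.Point.map ι.toRatAlgHom P = heegnerPointComplex Dt H →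
        ¬ IsOfFinAddOrder P →
        ∀ (κ : ZpExtension K p), κ.IsAnticyclotomic →
          ∀ (γ : Field.absoluteGaloisGroup K) [Fact (κ.IsTopGenerator γ)]
            (𝔭 : HeightOneSpectrum (𝓞 K)) (h𝔭 : ((p : ℕ) : 𝓞 K) ∈ 𝔭.asIdeal)
            (he : 𝔭.asIdeal.ramificationIdx (𝓞 ℚ) = 1) (hf : 𝔭.asIdeal.inertiaDeg (𝓞 ℚ) = 1),
            ∃ t : ℕ, Nat.card (localKer κ.kerSubgroup ((W.baseChange K).geomPrimaryTorsion p) 𝔭) = p ^ t := by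
  intro W _ _ p _ _ _ _ _ N _ K _ _ Dt H ι P _ _ _ _ _ _ _ _ _ _ κ _ γ _ 𝔭 h𝔭 he hf
  exact exists_natCard_localKer_eq_pow W p κ 𝔭 h𝔭 he hf

end Padic

end Summit.BirchSwinnertonDyer.BirchSwinnertonDyer.Theorems.SchneiderFreeAdditiveX3

end
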